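import Literature.AlgebraicGeometry.Motives.WeilJacobianDimension
import Literature.AlgebraicGeometry.HodgeTheory.JacobianDimensionFactReduction
import HarnessLib

/-!
# `2 dim J(C) = b₁(C)`: the named fact `two_mul_dim_eq_finrank_bettiCohomology` holds

The named fact `Motives.two_mul_dim_eq_finrank_bettiCohomology` (`Motives/Jacobian`: for a smooth
projective curve `C/ℂ` and a Jacobian `𝒥` of `C`, `2 dim 𝒥 = dim_ℚ H¹(C(ℂ), ℚ)`) is discharged.
By `HodgeTheory/JacobianDimensionFactReduction` (the Hodge decomposition `b₁(C) = 2 g(C)` and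
Milne's bound `dim 𝒥 ≤ g`) it suffices that `g(C) ≤ dim 𝒥` for every Jacobian, and this is
`curveGenus_le_jacobian_dim` (`Motives/WeilJacobianDimension`): Weil's construction of an abelian
variety `J` of dimension `g` generated by `C` (Milne, *Jacobian Varieties*, §7 Thm. 7.1), onto
which every Jacobian in the sense of the universal property maps.

## References

* J. S. Milne, *Jacobian Varieties*, in Cornell–Silverman (eds.), *Arithmetic Geometry* (1986),
  §2 Prop. 2.1, §7 Thm. 7.1. [Milne1986JacobianVarieties]
-/

noncomputable section

open CategoryTheory AlgebraicGeometry
open Literature.AlgebraicGeometry.HodgeTheory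

namespace Literature.AlgebraicGeometry.Motives

/-- **`2 dim J(C) = b₁(C)` for every smooth projective complex curve `C` and every Jacobian `J` of
`C`** (the named fact `two_mul_dim_eq_finrank_bettiCohomology` of `Motives/Jacobian` holds).
[cite: Milne1986JacobianVarieties, §2 Prop. 2.1 and §7 Thm. 7.1] -/
theorem two_mul_dim_eq_finrank_bettiCohomology_holds : two_mul_dim_eq_finrank_bettiCohomology :=
  two_mul_dim_eq_finrank_bettiCohomology_of_forall_exists_curveGenus_le_dim fun C _ _ _ hC h𝒥 ↦
    ⟨h𝒥.some, curveGenus_le_jacobian_dim C hC.isProjectiveOver h𝒥.some⟩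

end Literature.AlgebraicGeometry.Motives

end
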